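import Literature.Barriers.QuantumAdvantage.TQBFSavitchCode
import Literature.Barriers.QuantumAdvantage.TQBFFlatStep
import Literature.Barriers.QuantumAdvantage.TQBFMembership
import Literature.Computability.Complexity.Transducers
import Literature.Computability.Complexity.CodeFPFinite
import Mathlib.Tactic.DeriveFintype
import HarnessLib

/-!
# `TQBF` is `PSPACE`-hard, IV: the polynomial-time emitter of the flat QBF; `TQBF` is `PSPACE`-complete

Arora–Barak 2009, Thm. 4.13 (Stockmeyer–Meyer 1973), last step of the hardness half (p. 112): the
map `x ↦ ψ_{M,x}` "can be computed in polynomial time". Parts I–III (`TQBFSavitch.lean`,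
`TQBFFlatCoding.lean`, `TQBFFlatStep.lean`) construct, for a flat witness `W` of `L ∈ PSPACE`
(`SpaceMachinesFlat.lean`), the prenex formula `flatQBF W x` and prove
`x ∈ L ↔ (flatQBF W x).encode ∈ TQBF` (`mem_iff_encode_flatQBF_mem_TQBF`); the generic emitter
of part III′ (`TQBFSavitchCode.lean`, `codeFP_encode_savitchQBF`) reduces the polynomial-time
computability of `x ↦ (flatQBF W x).encode` to generators of the step formula
`ofTpl Nc (stepTpl Λ P) a b`, the acceptance formula `ofTpl₁ (accTpl Λ k₁ acc) a`, the start word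
`Λ.enc (cfgW W x 0)` and the bit count `Nc` (with `Λ = layW W |x|`). This file supplies them, in the
typed polynomial-time algebra `CodeFP` (`CodeFP.lean`), and concludes:

* **sizes from codes** (`nodeT`, `run_code`, `codeFP_size_of_code`): a finite-state transducer
  counting the nodes of a prefix code (`PropForm.code`), so that `encodingPropForm.encode φ =
  ⟨unary size, code⟩` is polynomial-time as soon as the code is (`codeFP_encode_of_code`) — no size
  bookkeeping is needed for the templates;
* codes of RENAMED combinators (`code_mapVars_vecEq`, `code_mapVars_vecConst`, …: the templates of
  part III are relocated by `PropForm.mapVars (remap Nc a b)`), and their generators with the leaf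
  renaming as a polynomial-time parameter (`codeFP_mvVecEq`, `codeFP_mvVecConstOnehot`, …);
* the layout quantities of `layW W n` in unary and binary (`cap = bound n + 2` through
  `Plumb.polyFn`), the instruction table of the fixed program `W.P` as a finite lookup
  (`CodeFP.ofList`; `instrData`), and the generators of `caseAt`/`stepTpl`/`accTpl` renamed to their
  blocks (`codeFP_stepCode`, `codeFP_accCode`), of the start word (`codeFP_startW`) and of `Nc`;
* **`codeFP_encode_flatQBF`**: `x ↦ (flatQBF W x).encode` is computed by an `FP` function;
  **`karpReducible_TQBF`**: `L ≤ₚ TQBF` for every `L` with a flat witness; **`isHard_PSPACE_TQBF`**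
  (every `L ∈ PSPACE` has a flat witness, `FlatProg.exists_flatWitness`); and with part M
  (`TQBFMembership.lean`, `TQBF_mem_PSPACE`) the completeness `isComplete_PSPACE_TQBF`.

## References

* S. Arora, B. Barak, *Computational Complexity: A Modern Approach*, CUP 2009, Thm. 4.13 (proof,
  p. 112: "ψ can be computed in polynomial time"), Def. 4.9, §1.3 [AroraBarakCC2009] (held;
  pp. 110–113 read).
* L. J. Stockmeyer, A. R. Meyer, *Word problems requiring exponential time*, Proc. 5th STOC (1973),
  1–9 (the original completeness theorem; attribution as in Arora–Barak [SM73]).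
-/

noncomputable section

namespace Literature.Barriers.QuantumAdvantage

open _root_.Computability Literature.Computability.Complexity Literature.Computability.Complexity.FlatProg

namespace TQBFRed

open CodeFP

/-! ### Sizes from codes: the node counter -/

/-- States of the node counter: expecting a tag (`t0`); after a first tag bit `1` (`t1`); expecting
the third bit of a binary connective (`t2`); after a first tag bit `0` (`z1`); expecting the value
bit of a constant (`cst`); inside a variable payload expecting the first bit of a pair (`v0`), or
its second bit after a `0` (`va`) / after a `1` (`vb`). [folklore] -/
inductive NSt : Type
  | t0 | t1 | t2 | z1 | cst | v0 | va | vb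
  deriving DecidableEq, Fintype

/-- The transition table of the node counter (one `1` emitted per node of the code). [folklore] -/
def nodeStep : NSt → Bool → NSt × List Bool
  | .t0, false => (.z1, [])
  | .t0, true => (.t1, [])
  | .t1, false => (.t0, [true])
  | .t1, true => (.t2, [])
  | .t2, _ => (.t0, [true])
  | .z1, false => (.v0, [true])
  | .z1, true => (.cst, [])
  | .cst, _ => (.t0, [true])
  | .v0, false => (.va, [])
  | .v0, true => (.vb, [])
  | .va, false => (.v0, [])
  | .va, true => (.t0, [])
  | .vb, false => (.t0, [])
  | .vb, true => (.v0, [])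

/-- **The node counter**: a finite-state transducer (`Transducers.lean`) that reads a prefix code
`PropForm.code φ` and emits `size φ` ones. [folklore] -/
def nodeT : FST NSt Bool Bool where
  init := .t0
  step := nodeStep
  front := fun _ => []
  keep := fun _ => true

/-- The step of the node counter. [folklore] -/
@[simp] theorem nodeT_step (s : NSt) (b : Bool) : nodeT.step s b = nodeStep s b := rfl

/-- The payload of a variable (doubled bits, then the separator `01`) is skipped silently. [folklore] -/
theorem run_payload (rest : List Bool) : ∀ w : List Bool,
    nodeT.run .v0 ((w.flatMap fun b => [b, b]) ++ false :: true :: rest) = nodeT.run .t0 rest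
  | [] => by simp [nodeStep]
  | b :: w => by
    rw [List.flatMap_cons, List.append_assoc]
    cases b <;> simp only [List.cons_append, List.nil_append, FST.run_cons, nodeT_step, nodeStep] <;>
      exact run_payload rest w

/-- **The node counter on a code** emits `size` ones and returns to the tag state. [folklore] -/
theorem run_code : ∀ (φ : PropForm ℕ) (rest : List Bool),
    nodeT.run .t0 (φ.code ++ rest) = ((nodeT.run .t0 rest).1, List.replicate φ.size true ++ (nodeT.run .t0 rest).2)
  | .var n, rest => by
    rw [PropForm.code, boolPair, List.append_nil]
    simp only [List.cons_append, List.append_assoc, FST.run_cons, nodeT_step, nodeStep,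
      List.nil_append, run_payload, PropForm.size, List.replicate_one]
  | .const b, rest => by
    cases b <;> simp [PropForm.code, nodeStep, PropForm.size]
  | .neg φ, rest => by
    simp only [PropForm.code, List.cons_append, FST.run_cons, nodeT_step, nodeStep, run_code φ rest,
      PropForm.size, List.replicate_succ, List.nil_append]
  | .conj φ ψ, rest => by
    simp only [PropForm.code, List.cons_append, List.append_assoc, FST.run_cons, nodeT_step, nodeStep,
      run_code φ (ψ.code ++ rest), run_code ψ rest, PropForm.size, List.nil_append]
    rw [List.replicate_succ, List.replicate_add]
    simp only [List.cons_append, List.append_assoc]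
  | .disj φ ψ, rest => by
    simp only [PropForm.code, List.cons_append, List.append_assoc, FST.run_cons, nodeT_step, nodeStep,
      run_code φ (ψ.code ++ rest), run_code ψ rest, PropForm.size, List.nil_append]
    rw [List.replicate_succ, List.replicate_add]
    simp only [List.cons_append, List.append_assoc]

/-- The node counter computes the unary size from the code. [folklore] -/
theorem eval_code (φ : PropForm ℕ) : nodeT.eval φ.code = unE φ.size := by
  have h := run_code φ []
  rw [List.append_nil] at h
  change nodeT.front (nodeT.run .t0 φ.code).1 ++
    (if nodeT.keep (nodeT.run .t0 φ.code).1 = true then (nodeT.run .t0 φ.code).2 else []) = _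
  rw [h, unE_eq_ones]
  simp [nodeT, ones]

section SizeOfCode

variable {γ : Type} {eγ : γ → List Bool}

/-- **Sizes from codes**: if the code of a formula is generated in polynomial time, so is its
(unary) size. [cite: AroraBarakCC2009, §1.3] -/
theorem codeFP_size_of_code {φ : γ → PropForm ℕ} (h : CodeFP eγ strE (fun t => (φ t).code)) :
    CodeFP eγ unE (fun t => (φ t).size) := by
  have hT : CodeFP strE strE nodeT.eval := of_fn nodeT.eval nodeT.polyTimeComputable_eval fun _ => rfl
  exact (hT.comp h).recodeOut fun t => eval_code (φ t)

/-- Hence the full code `⟨unary size, code⟩` of a generated formula is polynomial-time.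
[cite: AroraBarakCC2009, §0.1 and §1.3] -/
theorem codeFP_encode_of_code {φ : γ → PropForm ℕ} (h : CodeFP eγ strE (fun t => (φ t).code)) :
    CodeFP eγ strE (fun t => encodingPropForm.encode (φ t)) :=
  ((codeFP_size_of_code h).pair h).recodeOut fun t => by
    simp only [pairE_apply, encodingPropForm, unE, strE, id]

end SizeOfCode

/-! ### Codes of renamed combinators -/

/-- Renaming distributes over `bigConj`. [folklore] -/
theorem mapVars_bigConj (f : ℕ → ℕ) (l : List (PropForm ℕ)) : (bigConj l).mapVars f = bigConj (l.map (·.mapVars f)) := by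
  induction l with
  | nil => rfl
  | cons φ l ih => rw [bigConj, PropForm.mapVars, ih, List.map_cons, bigConj]

/-- Renamed `bitEq`. [folklore] -/
@[simp] theorem mapVars_bitEq (f : ℕ → ℕ) (u v : ℕ) : (bitEq u v).mapVars f = bitEq (f u) (f v) := rfl

/-- Renamed `vecEq`: a conjunction of renamed bit equalities. [folklore] -/
theorem mapVars_vecEq (f : ℕ → ℕ) (a b m : ℕ) :
    (vecEq a b m).mapVars f = bigConj ((List.range m).map fun j => bitEq (f (a + j)) (f (b + j))) := by
  rw [vecEq, mapVars_bigConj, List.map_map]; rfl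

/-- `code` of a renamed `vecEq`. [folklore] -/
theorem code_mapVars_vecEq (f : ℕ → ℕ) (a b m : ℕ) : ((vecEq a b m).mapVars f).code =
    ((List.range m).map fun j => [true, true, false] ++ (bitEq (f (a + j)) (f (b + j))).code).flatten ++ [false, true, true] := by
  rw [mapVars_vecEq, code_bigConj, List.map_map]; rfl

/-- Renamed `bitLit`. [folklore] -/
@[simp] theorem mapVars_bitLit (f : ℕ → ℕ) (u : ℕ) (b : Bool) : (bitLit u b).mapVars f = bitLit (f u) b := by
  cases b <;> rfl

/-- `code` of a renamed `vecConst`, indexed from `base`. [folklore] -/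
theorem code_mapVars_vecConst_range' (f : ℕ → ℕ) : ∀ (base : ℕ) (w : List Bool), ((vecConst base w).mapVars f).code =
    (((List.range' base w.length).zip w).map fun p => [true, true, false] ++ (bitLit (f p.1) p.2).code).flatten ++
      [false, true, true]
  | base, [] => rfl
  | base, b :: w => by
    rw [vecConst, PropForm.mapVars, PropForm.code, mapVars_bitLit, code_mapVars_vecConst_range' f (base + 1) w,
      List.length_cons, List.range'_succ, List.zip_cons_cons, List.map_cons, List.flatten_cons]
    simp

/-- `code` of a renamed `vecConst`, over the indexed bits of the word. [folklore] -/
theorem code_mapVars_vecConst (f : ℕ → ℕ) (base : ℕ) (w : List Bool) : ((vecConst base w).mapVars f).code =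
    (((List.range w.length).zip w).map fun p => [true, true, false] ++ (bitLit (f (base + p.1)) p.2).code).flatten ++
      [false, true, true] := by
  rw [code_mapVars_vecConst_range', List.range'_eq_map_range, List.zip_map_left, List.map_map]
  congr 2

/-- The indexed bits of a one-hot word. [folklore] -/
theorem zip_onehot (n j : ℕ) : (List.range n).zip (onehot n j) = (List.range n).map fun p => (p, decide (j = p)) := by
  refine List.ext_getElem (by simp) fun i h₁ h₂ => ?_
  rw [List.length_map, List.length_range] at h₂
  rw [List.getElem_zip, List.getElem_map, List.getElem_range, getElem_onehot]

/-- `code` of a renamed `vecConst` of a one-hot word. [folklore] -/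
theorem code_mapVars_vecConst_onehot (f : ℕ → ℕ) (base n j : ℕ) : ((vecConst base (onehot n j)).mapVars f).code =
    ((List.range n).map fun p => [true, true, false] ++ (bitLit (f (base + p)) (decide (j = p))).code).flatten ++
      [false, true, true] := by
  rw [code_mapVars_vecConst, length_onehot, zip_onehot, List.map_map]; rfl

/-- `code` of a renamed guarded item `var p ⇒ ψ`. [folklore] -/
theorem code_mapVars_impF_var (f : ℕ → ℕ) (p : ℕ) (ψ : PropForm ℕ) :
    ((impF (.var p) ψ).mapVars f).code = [true, true, true, true, false] ++ (varCode (f p) ++ (ψ.mapVars f).code) := rfl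

/-- `code` of a renamed conjunction. [folklore] -/
theorem code_mapVars_conj (f : ℕ → ℕ) (φ ψ : PropForm ℕ) :
    ((PropForm.conj φ ψ).mapVars f).code = [true, true, false] ++ ((φ.mapVars f).code ++ (ψ.mapVars f).code) := rfl

/-! ### Generators of renamed combinators (the renaming as a polynomial-time parameter) -/

section Mapped

variable {γ : Type} {eγ : γ → List Bool} {r : γ → ℕ → ℕ}

/-- Unary product. [folklore] -/
theorem unMul : CodeFP (pairE unE unE) unE (fun p => p.1 * p.2) :=
  ((ulength unitE).comp (unitsMul.comp ((replicateUnit.comp (fst unE unE)).pair (replicateUnit.comp (snd unE unE))))).congr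
    fun p => by simp

/-- Unary predecessor. [folklore] -/
theorem unPred : CodeFP unE unE (fun n => n - 1) := by
  have h : CodeFP unE strE (fun n => (unE n).drop 1) := strDrop.comp ((const unE (eβ := unE) 1).pair strOfUn)
  exact h.recodeOut fun n => by rw [unE_eq_ones, unE_eq_ones]; simp [ones, List.drop_replicate]

/-- Singletons flatten to a `map`. [folklore] -/
theorem flatten_map_singleton {α β : Type} (g : α → β) (l : List α) : (l.map fun a => [g a]).flatten = l.map g := by
  induction l with
  | nil => rfl
  | cons a l ih => rw [List.map_cons, List.flatten_cons, ih, List.singleton_append, List.map_cons]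

/-- Renamed variable codes, from `(t, v)`. [folklore] -/
theorem codeFP_mvVar (hr : CodeFP (pairE eγ natE) natE (fun q => r q.1 q.2)) :
    CodeFP (pairE eγ natE) strE (fun q => varCode (r q.1 q.2)) :=
  codeFP_varCode.comp hr

/-- Renamed bit equalities, from `(t, u, v)`. [folklore] -/
theorem codeFP_mvBitEq (hr : CodeFP (pairE eγ natE) natE (fun q => r q.1 q.2)) :
    CodeFP (pairE eγ (pairE natE natE)) strE (fun q => (bitEq (r q.1 q.2.1) (r q.1 q.2.2)).code) := by
  have ht : CodeFP (pairE eγ (pairE natE natE)) eγ (fun q => q.1) := fst _ _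
  have hu₀ := (codeFP_mvVar hr).comp (ht.pair (snd eγ (pairE natE natE)).fst')
  have hu : CodeFP (pairE eγ (pairE natE natE)) strE (fun q => varCode (r q.1 q.2.1)) := hu₀
  have hv₀ := (codeFP_mvVar hr).comp (ht.pair (snd eγ (pairE natE natE)).snd')
  have hv : CodeFP (pairE eγ (pairE natE natE)) strE (fun q => varCode (r q.1 q.2.2)) := hv₀
  have c1 : CodeFP (pairE eγ (pairE natE natE)) strE (fun _ => [true, true, true, true, true, false]) := const _ _
  have c2 : CodeFP (pairE eγ (pairE natE natE)) strE (fun _ => [true, true, false, true, false]) := const _ _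
  have c3 : CodeFP (pairE eγ (pairE natE natE)) strE (fun _ => [true, false]) := const _ _
  have e6 : CodeFP (pairE eγ (pairE natE natE)) strE (fun q => [true, false] ++ varCode (r q.1 q.2.2)) :=
    strAppend.comp (c3.pair hv)
  have e5 : CodeFP (pairE eγ (pairE natE natE)) strE (fun q => varCode (r q.1 q.2.1) ++ ([true, false] ++ varCode (r q.1 q.2.2))) :=
    strAppend.comp (hu.pair e6)
  have e4 : CodeFP (pairE eγ (pairE natE natE)) strE (fun q => [true, true, false, true, false] ++ (varCode (r q.1 q.2.1) ++
      ([true, false] ++ varCode (r q.1 q.2.2)))) := strAppend.comp (c2.pair e5)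
  have e3 : CodeFP (pairE eγ (pairE natE natE)) strE (fun q => varCode (r q.1 q.2.2) ++ ([true, true, false, true, false] ++
      (varCode (r q.1 q.2.1) ++ ([true, false] ++ varCode (r q.1 q.2.2))))) := strAppend.comp (hv.pair e4)
  have e2 : CodeFP (pairE eγ (pairE natE natE)) strE (fun q => varCode (r q.1 q.2.1) ++ (varCode (r q.1 q.2.2) ++
      ([true, true, false, true, false] ++ (varCode (r q.1 q.2.1) ++ ([true, false] ++ varCode (r q.1 q.2.2)))))) :=
    strAppend.comp (hu.pair e3)
  exact (strAppend.comp (c1.pair e2)).congr fun q => by rw [code_bitEq]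

/-- **Renamed `vecEq`**, from `(t, a, b, 1ᵐ)`. [cite: AroraBarakCC2009, Thm. 4.13 (proof: the block equalities)] -/
theorem codeFP_mvVecEq (hr : CodeFP (pairE eγ natE) natE (fun q => r q.1 q.2)) :
    CodeFP (pairE eγ (pairE natE (pairE natE unE))) strE
      (fun q => ((vecEq q.2.1 q.2.2.1 q.2.2.2).mapVars (r q.1)).code) := by
  -- context `c = (t, a, b, 1ᵐ)`, item `j`
  have hc : CodeFP (pairE (pairE eγ (pairE natE (pairE natE unE))) natE) (pairE eγ (pairE natE (pairE natE unE))) (fun q => q.1) :=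
    fst _ _
  have hj : CodeFP (pairE (pairE eγ (pairE natE (pairE natE unE))) natE) natE (fun q => q.2) := snd _ _
  have ha : CodeFP (pairE (pairE eγ (pairE natE (pairE natE unE))) natE) natE (fun q => q.1.2.1 + q.2) :=
    natAdd.comp (hc.snd'.fst'.pair hj)
  have hb : CodeFP (pairE (pairE eγ (pairE natE (pairE natE unE))) natE) natE (fun q => q.1.2.2.1 + q.2) :=
    natAdd.comp (hc.snd'.snd'.fst'.pair hj)
  have hbe₀ := (codeFP_mvBitEq hr).comp (hc.fst'.pair (ha.pair hb))
  have hbe : CodeFP (pairE (pairE eγ (pairE natE (pairE natE unE))) natE) strE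
      (fun q => (bitEq (r q.1.1 (q.1.2.1 + q.2)) (r q.1.1 (q.1.2.2.1 + q.2))).code) := hbe₀
  have c110 : CodeFP (pairE (pairE eγ (pairE natE (pairE natE unE))) natE) strE (fun _ => [true, true, false]) := const _ _
  have hg : CodeFP (pairE (pairE eγ (pairE natE (pairE natE unE))) natE) strE
      (fun q => [true, true, false] ++ (bitEq (r q.1.1 (q.1.2.1 + q.2)) (r q.1.1 (q.1.2.2.1 + q.2))).code) :=
    strAppend.comp (c110.pair hbe)
  have hrange : CodeFP (pairE eγ (pairE natE (pairE natE unE))) (pairE (pairE eγ (pairE natE (pairE natE unE))) (rawE natE))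
      (fun q => (q, List.range q.2.2.2)) := (CodeFP.id _).pair (urange.comp (snd _ _).snd'.snd')
  have hl : CodeFP (pairE eγ (pairE natE (pairE natE unE))) (rawE strE) (fun q => (List.range q.2.2.2).map fun j =>
      [true, true, false] ++ (bitEq (r q.1 (q.2.1 + j)) (r q.1 (q.2.2.1 + j))).code) := ((map hg).comp hrange).congr fun _ => rfl
  have c011 : CodeFP (pairE eγ (pairE natE (pairE natE unE))) strE (fun _ => [false, true, true]) := const _ _
  exact (strAppend.comp ((strJoin.comp hl).pair c011)).congr fun q => by rw [code_mapVars_vecEq]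

/-- **Renamed `vecConst` of a one-hot word**, from `(t, base, j)`, the length `n t` of the word being
polynomial-time in unary. [cite: AroraBarakCC2009, Thm. 4.13 (proof: "plugging in" constant blocks)] -/
theorem codeFP_mvVecConstOnehot (hr : CodeFP (pairE eγ natE) natE (fun q => r q.1 q.2)) {n : γ → ℕ} (hn : CodeFP eγ unE n) :
    CodeFP (pairE eγ (pairE natE natE)) strE (fun q => ((vecConst q.2.1 (onehot (n q.1) q.2.2)).mapVars (r q.1)).code) := by
  -- context `c = (t, base, j)`, item `p`
  have hc : CodeFP (pairE (pairE eγ (pairE natE natE)) natE) (pairE eγ (pairE natE natE)) (fun q => q.1) := fst _ _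
  have hp : CodeFP (pairE (pairE eγ (pairE natE natE)) natE) natE (fun q => q.2) := snd _ _
  have hjj : CodeFP (pairE (pairE eγ (pairE natE natE)) natE) natE (fun q => q.1.2.2) := hc.snd'.snd'
  have hcond₀ := natEq.comp (hjj.pair hp)
  have hcond : CodeFP (pairE (pairE eγ (pairE natE natE)) natE) bitE (fun q => decide (q.1.2.2 = q.2)) := hcond₀
  have hnil : CodeFP (pairE (pairE eγ (pairE natE natE)) natE) strE (fun _ => []) := const _ _
  have h10 : CodeFP (pairE (pairE eγ (pairE natE natE)) natE) strE (fun _ => [true, false]) := const _ _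
  have hite : CodeFP (pairE (pairE eγ (pairE natE natE)) natE) strE (fun q => if decide (q.1.2.2 = q.2) then [] else [true, false]) :=
    hcond.ite hnil h10
  have hbase : CodeFP (pairE (pairE eγ (pairE natE natE)) natE) natE (fun q => q.1.2.1) := hc.snd'.fst'
  have hidx₀ := natAdd.comp (hbase.pair hp)
  have hidx : CodeFP (pairE (pairE eγ (pairE natE natE)) natE) natE (fun q => q.1.2.1 + q.2) := hidx₀
  have ht : CodeFP (pairE (pairE eγ (pairE natE natE)) natE) eγ (fun q => q.1.1) := hc.fst'
  have hvar₀ := (codeFP_mvVar hr).comp (ht.pair hidx)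
  have hvar : CodeFP (pairE (pairE eγ (pairE natE natE)) natE) strE (fun q => varCode (r q.1.1 (q.1.2.1 + q.2))) := hvar₀
  have c110 : CodeFP (pairE (pairE eγ (pairE natE natE)) natE) strE (fun _ => [true, true, false]) := const _ _
  have hin₀ := strAppend.comp (hite.pair hvar)
  have hin : CodeFP (pairE (pairE eγ (pairE natE natE)) natE) strE
      (fun q => (if decide (q.1.2.2 = q.2) then [] else [true, false]) ++ varCode (r q.1.1 (q.1.2.1 + q.2))) := hin₀
  have hg₀ := strAppend.comp (c110.pair hin)
  have hg : CodeFP (pairE (pairE eγ (pairE natE natE)) natE) strE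
      (fun q => [true, true, false] ++ ((if decide (q.1.2.2 = q.2) then [] else [true, false]) ++ varCode (r q.1.1 (q.1.2.1 + q.2)))) :=
    hg₀
  have hnq₀ := hn.comp (fst eγ (pairE natE natE))
  have hnq : CodeFP (pairE eγ (pairE natE natE)) unE (fun q => n q.1) := hnq₀
  have hrq₀ := urange.comp hnq
  have hrq : CodeFP (pairE eγ (pairE natE natE)) (rawE natE) (fun q => List.range (n q.1)) := hrq₀
  have hrange : CodeFP (pairE eγ (pairE natE natE)) (pairE (pairE eγ (pairE natE natE)) (rawE natE)) (fun q => (q, List.range (n q.1))) :=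
    (CodeFP.id _).pair hrq
  have hl₀ := (map hg).comp hrange
  have hl : CodeFP (pairE eγ (pairE natE natE)) (rawE strE) (fun q => (List.range (n q.1)).map fun p =>
      [true, true, false] ++ ((if decide (q.2.2 = p) then [] else [true, false]) ++ varCode (r q.1 (q.2.1 + p)))) :=
    hl₀.congr fun _ => rfl
  have hj₀ := strJoin.comp hl
  have hj : CodeFP (pairE eγ (pairE natE natE)) strE (fun q => ((List.range (n q.1)).map fun p =>
      [true, true, false] ++ ((if decide (q.2.2 = p) then [] else [true, false]) ++ varCode (r q.1 (q.2.1 + p)))).flatten) := hj₀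
  have c011 : CodeFP (pairE eγ (pairE natE natE)) strE (fun _ => [false, true, true]) := const _ _
  have hall₀ := strAppend.comp (hj.pair c011)
  refine hall₀.congr fun q => ?_
  dsimp only
  rw [code_mapVars_vecConst_onehot]
  congr 2
  refine List.map_congr_left fun p _ => ?_
  by_cases h : q.2.2 = p <;> simp [h, code_bitLit]

/-- **Renamed conjunction.** [folklore] -/
theorem codeFP_mvConj {φ ψ : γ → PropForm ℕ} (hφ : CodeFP eγ strE (fun t => ((φ t).mapVars (r t)).code))
    (hψ : CodeFP eγ strE (fun t => ((ψ t).mapVars (r t)).code)) :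
    CodeFP eγ strE (fun t => ((PropForm.conj (φ t) (ψ t)).mapVars (r t)).code) := by
  have c110 : CodeFP eγ strE (fun _ => [true, true, false]) := const _ _
  have h₀ := strAppend.comp (hφ.pair hψ)
  have h₁ := strAppend.comp (c110.pair h₀)
  exact h₁.congr fun t => by rw [code_mapVars_conj]

/-- **Renamed case distinction** on a polynomial-time condition. [folklore] -/
theorem codeFP_mvIte {p : γ → Prop} [DecidablePred p] {φ ψ : γ → PropForm ℕ} (hp : CodeFP eγ bitE (fun t => decide (p t)))
    (hφ : CodeFP eγ strE (fun t => ((φ t).mapVars (r t)).code)) (hψ : CodeFP eγ strE (fun t => ((ψ t).mapVars (r t)).code)) :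
    CodeFP eγ strE (fun t => ((if p t then φ t else ψ t).mapVars (r t)).code) :=
  (hp.ite hφ hψ).congr fun t => by by_cases h : p t <;> simp [h]

end Mapped

/-! ### The layout of a flat witness, in polynomial time -/

/-- Unary subtraction. [folklore] -/
theorem unSub : CodeFP (pairE unE unE) unE (fun p => p.1 - p.2) := by
  have h₀ := strDrop.comp ((snd unE unE).pair (strOfUn.comp (fst unE unE)))
  have h : CodeFP (pairE unE unE) strE (fun p => (unE p.1).drop p.2) := h₀
  exact h.recodeOut fun p => by rw [unE_eq_ones, unE_eq_ones]; simp [ones, List.drop_replicate]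

/-- The descriptor of an (optional) instruction: `(tag, k, a, j, t)` with tag `0` = `goto j`,
`1` = `push k a j`, `2` = `pop k t`, `3` = halted. [folklore] -/
def instrData : Option Instr → ℕ × (ℕ × (ℕ × (ℕ × List ℕ)))
  | some (.goto j) => (0, 0, 0, j, [])
  | some (.push k a j) => (1, k, a, j, [])
  | some (.pop k t) => (2, k, 0, 0, t)
  | none => (3, 0, 0, 0, [])

/-- The constraint of a descriptor (a mirror of `caseAt`/`caseInstr` of part III). [folklore] -/
def caseOfData (Λ : Lay) (d : ℕ × (ℕ × (ℕ × (ℕ × List ℕ)))) : PropForm ℕ :=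
  if d.1 = 0 then .conj (pcIs Λ Λ.Nc d.2.2.2.1) (allRegsEq Λ)
  else if d.1 = 1 then caseInstr Λ (.push d.2.1 d.2.2.1 d.2.2.2.1)
  else if d.1 = 2 then caseInstr Λ (.pop d.2.1 d.2.2.2.2)
  else vecEq Λ.Nc 0 Λ.Nc

/-- `caseAt` through the descriptor of the instruction. [folklore] -/
theorem caseAt_eq_caseOfData (Λ : Lay) (P : Prog) (p : ℕ) : caseAt Λ P p = caseOfData Λ (instrData P[p]?) := by
  unfold caseAt
  cases P[p]? with
  | none => simp [caseOfData, instrData]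
  | some i => cases i <;> simp [caseOfData, instrData, caseInstr]

section Witness

variable {L : Language Bool} (W : FlatWitness L)

/-- The code of the descriptors. [folklore] -/
local notation "DE" => pairE natE (pairE unE (pairE natE (pairE natE (rawE natE))))
/-- The code of the emitter's context `(x, a, b)`. [folklore] -/
local notation "CE" => pairE strE (pairE natE natE)
/-- The code of the context with a descriptor. [folklore] -/
local notation "QE" => pairE (pairE strE (pairE natE natE)) (pairE natE (pairE unE (pairE natE (pairE natE (rawE natE)))))

/-- **The capacity `bound n + 2` is polynomial-time in unary** (`Plumb.polyFn`). [folklore] -/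
theorem codeFP_capW : CodeFP strE unE (fun x => (layW W x.length).cap) := by
  have hb : CodeFP strE unE (fun x => W.bound.eval x.length) :=
    of_fn (Plumb.polyFn W.bound) (Plumb.polyFn_mem_FP _) fun x => by rw [Plumb.polyFn_apply, unE_eq_ones]; rfl
  have h2 : CodeFP strE unE (fun _ => 2) := const _ _
  have h₀ := unAdd.comp (hb.pair h2)
  exact h₀.congr fun _ => rfl

/-- The region width `Wr = cap · Wc`, unary. [folklore] -/
theorem codeFP_WrW : CodeFP strE unE (fun x => (layW W x.length).Wr) := by
  have hWc : CodeFP strE unE (fun _ => W.N + 2) := const _ _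
  have h₀ := unMul.comp ((codeFP_capW W).pair hWc)
  exact h₀.congr fun _ => rfl

/-- **The bit count `Nc = H + 1 + K · Wr`, unary.** [folklore] -/
theorem codeFP_NcW : CodeFP strE unE (fun x => (layW W x.length).Nc) := by
  have hH : CodeFP strE unE (fun _ => W.P.length + 1) := const _ _
  have hK : CodeFP strE unE (fun _ => W.K) := const _ _
  have h1 := unMul.comp (hK.pair (codeFP_WrW W))
  have h₀ := unAdd.comp (hH.pair h1)
  exact h₀.congr fun _ => rfl

/-- The bit count, binary. [folklore] -/
theorem codeFP_NcWb : CodeFP strE natE (fun x => (layW W x.length).Nc) := (natOfUn.comp (codeFP_NcW W)).congr fun _ => rfl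

/-- The region width, binary. [folklore] -/
theorem codeFP_WrWb : CodeFP strE natE (fun x => (layW W x.length).Wr) := (natOfUn.comp (codeFP_WrW W)).congr fun _ => rfl

/-- The capacity, binary. [folklore] -/
theorem codeFP_capWb : CodeFP strE natE (fun x => (layW W x.length).cap) := (natOfUn.comp (codeFP_capW W)).congr fun _ => rfl

/-- **The renaming of the emitter's context** `(x, a, b)`: `remap Nc a b` (part III's `ofTpl`). [folklore] -/
def rC (c : List Bool × (ℕ × ℕ)) (v : ℕ) : ℕ := remap (layW W c.1.length).Nc c.2.1 c.2.2 v

/-- **The renaming is polynomial-time**, from `((x, a, b), v)`. [folklore] -/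
theorem codeFP_remapW : CodeFP (pairE CE natE) natE (fun q => rC W q.1 q.2) := by
  have hx : CodeFP (pairE CE natE) strE (fun q => q.1.1) := (fst _ _).fst'
  have hNc₀ := (codeFP_NcWb W).comp hx
  have hNc : CodeFP (pairE CE natE) natE (fun q => (layW W q.1.1.length).Nc) := hNc₀
  have hv : CodeFP (pairE CE natE) natE (fun q => q.2) := snd _ _
  have ha : CodeFP (pairE CE natE) natE (fun q => q.1.2.1) := (fst _ _).snd'.fst'
  have hb : CodeFP (pairE CE natE) natE (fun q => q.1.2.2) := (fst _ _).snd'.snd'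
  have hlt₀ := natLt.comp (hv.pair hNc)
  have hlt : CodeFP (pairE CE natE) bitE (fun q => decide (q.2 < (layW W q.1.1.length).Nc)) := hlt₀
  have h1₀ := natAdd.comp (ha.pair hv)
  have h1 : CodeFP (pairE CE natE) natE (fun q => q.1.2.1 + q.2) := h1₀
  have hs₀ := natSub.comp (hv.pair hNc)
  have hs : CodeFP (pairE CE natE) natE (fun q => q.2 - (layW W q.1.1.length).Nc) := hs₀
  have h2₀ := natAdd.comp (hb.pair hs)
  have h2 : CodeFP (pairE CE natE) natE (fun q => q.1.2.2 + (q.2 - (layW W q.1.1.length).Nc)) := h2₀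
  exact (hlt.ite h1 h2).congr fun q => by by_cases h : q.2 < (layW W q.1.1.length).Nc <;> simp [rC, remap, h]

/-- **The instruction table of the fixed program**, as a finite lookup (`CodeFP.ofList`): the
descriptor of `W.P[p]?` from `p` (the stack index in unary). [cite: AroraBarakCC2009, §1.3 (finite functions)] -/
theorem codeFP_table : CodeFP natE DE (fun p => instrData W.P[p]?) := by
  refine (ofList natE_injective _ (fun p => instrData W.P[p]?) (instrData none) (List.range (W.P.length + 1))).congr
    fun p => ?_
  by_cases hp : p ∈ List.range (W.P.length + 1)
  · rw [if_pos hp]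
  · have hp' : W.P.length ≤ p := by rw [List.mem_range] at hp; omega
    rw [if_neg hp, List.getElem?_eq_none hp']

/-! ### The pieces of the step template, renamed to the blocks of the context -/

/-- **The renaming of the context with a descriptor**: `remap Nc a b` of its `(x, a, b)` part. [folklore] -/
def rQ (q : (List Bool × (ℕ × ℕ)) × (ℕ × (ℕ × (ℕ × (ℕ × List ℕ))))) (v : ℕ) : ℕ := rC W q.1 v

/-- The renaming of the context with a descriptor and an item. [folklore] -/
def rQN (s : ((List Bool × (ℕ × ℕ)) × (ℕ × (ℕ × (ℕ × (ℕ × List ℕ))))) × ℕ) (v : ℕ) : ℕ := rQ W s.1 v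


/-- The renaming of a context with a descriptor is polynomial-time. [folklore] -/
theorem codeFP_remapQ : CodeFP (pairE QE natE) natE (fun s => rQ W s.1 s.2) := by
  have h₀ := (codeFP_remapW W).comp ((fst QE natE).fst'.pair (snd QE natE))
  exact h₀

/-- The renaming of a context with a descriptor and an item is polynomial-time. [folklore] -/
theorem codeFP_remapQN : CodeFP (pairE (pairE QE natE) natE) natE (fun s => rQN W s.1 s.2) := by
  have h₀ := (codeFP_remapW W).comp ((fst (pairE QE natE) natE).fst'.fst'.pair (snd (pairE QE natE) natE))
  exact h₀

/-- The input word of the context. [folklore] -/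
theorem codeFP_Qx : CodeFP QE strE (fun q => q.1.1) := (fst _ _).fst'
/-- The bit count at the context. [folklore] -/
theorem codeFP_QNcb : CodeFP QE natE (fun q => (layW W q.1.1.length).Nc) := by
  have h₀ := (codeFP_NcWb W).comp codeFP_Qx; exact h₀
/-- The bit count at the context, unary. [folklore] -/
theorem codeFP_QNcU : CodeFP QE unE (fun q => (layW W q.1.1.length).Nc) := by
  have h₀ := (codeFP_NcW W).comp codeFP_Qx; exact h₀
/-- The region width at the context, unary. [folklore] -/
theorem codeFP_QWrU : CodeFP QE unE (fun q => (layW W q.1.1.length).Wr) := by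
  have h₀ := (codeFP_WrW W).comp codeFP_Qx; exact h₀
/-- The region width at the context, binary. [folklore] -/
theorem codeFP_QWrb : CodeFP QE natE (fun q => (layW W q.1.1.length).Wr) := by
  have h₀ := (codeFP_WrWb W).comp codeFP_Qx; exact h₀
/-- The capacity at the context, unary. [folklore] -/
theorem codeFP_QcapU : CodeFP QE unE (fun q => (layW W q.1.1.length).cap) := by
  have h₀ := (codeFP_capW W).comp codeFP_Qx; exact h₀
/-- The capacity at the context, binary. [folklore] -/
theorem codeFP_Qcapb : CodeFP QE natE (fun q => (layW W q.1.1.length).cap) := by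
  have h₀ := (codeFP_capWb W).comp codeFP_Qx; exact h₀
/-- The stack index of the descriptor, unary. [folklore] -/
theorem codeFP_QkU : CodeFP QE unE (fun q => q.2.2.1) := (snd _ _).snd'.fst'
/-- The stack index of the descriptor, binary. [folklore] -/
theorem codeFP_Qkb : CodeFP QE natE (fun q => q.2.2.1) := (natOfUn.comp codeFP_QkU).congr fun _ => rfl

/-- The offset `off k 0` of the descriptor's stack. [folklore] -/
theorem codeFP_Qoff0 : CodeFP QE natE (fun q => (layW W q.1.1.length).off q.2.2.1 0) := by
  have hH : CodeFP QE natE (fun _ => W.P.length + 1) := const _ _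
  have h0 : CodeFP QE natE (fun _ => 0 * (W.N + 2)) := const _ _
  have h1₀ := natMul.comp (codeFP_Qkb.pair (codeFP_QWrb W))
  have h1 : CodeFP QE natE (fun q => q.2.2.1 * (layW W q.1.1.length).Wr) := h1₀
  have h2₀ := natAdd.comp (hH.pair h1)
  have h3₀ := natAdd.comp (h2₀.pair h0)
  exact h3₀.congr fun _ => rfl

/-- The offset `off (k + 1) 0` after the descriptor's stack. [folklore] -/
theorem codeFP_Qoff1 : CodeFP QE natE (fun q => (layW W q.1.1.length).off (q.2.2.1 + 1) 0) := by
  have hH : CodeFP QE natE (fun _ => W.P.length + 1) := const _ _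
  have h0 : CodeFP QE natE (fun _ => 0 * (W.N + 2)) := const _ _
  have c1 : CodeFP QE natE (fun _ => 1) := const _ _
  have hk1₀ := natAdd.comp (codeFP_Qkb.pair c1)
  have hk1 : CodeFP QE natE (fun q => q.2.2.1 + 1) := hk1₀
  have h1₀ := natMul.comp (hk1.pair (codeFP_QWrb W))
  have h1 : CodeFP QE natE (fun q => (q.2.2.1 + 1) * (layW W q.1.1.length).Wr) := h1₀
  have h2₀ := natAdd.comp (hH.pair h1)
  have h3₀ := natAdd.comp (h2₀.pair h0)
  exact h3₀.congr fun _ => rfl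

/-- `(cap - 1) · Wc`, unary. [folklore] -/
theorem codeFP_QshiftU : CodeFP QE unE (fun q => ((layW W q.1.1.length).cap - 1) * (layW W q.1.1.length).Wc) := by
  have hWc : CodeFP QE unE (fun _ => W.N + 2) := const _ _
  have hp₀ := unPred.comp (codeFP_QcapU W)
  have hp : CodeFP QE unE (fun q => (layW W q.1.1.length).cap - 1) := hp₀
  have h₀ := unMul.comp (hp.pair hWc)
  exact h₀.congr fun _ => rfl

/-- `(cap - 1) · Wc`, binary. [folklore] -/
theorem codeFP_Qshiftb : CodeFP QE natE (fun q => ((layW W q.1.1.length).cap - 1) * (layW W q.1.1.length).Wc) :=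
  (natOfUn.comp (codeFP_QshiftU W)).congr fun _ => rfl

variable {W}

/-- A renamed `vecEq` at the context, from generators of its three parameters. [folklore] -/
theorem codeFP_QvecEq {a b m : (List Bool × (ℕ × ℕ)) × (ℕ × (ℕ × (ℕ × (ℕ × List ℕ)))) → ℕ}
    (ha : CodeFP QE natE a) (hb : CodeFP QE natE b) (hm : CodeFP QE unE m) :
    CodeFP QE strE (fun q => ((vecEq (a q) (b q) (m q)).mapVars (rQ W q)).code) := by
  have h₀ := (codeFP_mvVecEq (codeFP_remapQ W)).comp ((CodeFP.id _).pair (ha.pair (hb.pair hm)))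
  exact h₀

/-- A renamed `vecConst` of a one-hot word at the context, from generators of the base and the position. [folklore] -/
theorem codeFP_QvecConst {base j : (List Bool × (ℕ × ℕ)) × (ℕ × (ℕ × (ℕ × (ℕ × List ℕ)))) → ℕ} (n : ℕ)
    (hbase : CodeFP QE natE base) (hj : CodeFP QE natE j) :
    CodeFP QE strE (fun q => ((vecConst (base q) (onehot n (j q))).mapVars (rQ W q)).code) := by
  have hn : CodeFP QE unE (fun _ => n) := const _ _
  have h₀ := (codeFP_mvVecConstOnehot (codeFP_remapQ W) hn).comp ((CodeFP.id _).pair (hbase.pair hj))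
  exact h₀

variable (W)

/-- `pcIs Λ Nc j` renamed, for a generated `j`. [cite: AroraBarakCC2009, Thm. 4.13 (proof) and Claim 4.4] -/
theorem codeFP_QpcIs {j : (List Bool × (ℕ × ℕ)) × (ℕ × (ℕ × (ℕ × (ℕ × List ℕ)))) → ℕ} (hj : CodeFP QE natE j) :
    CodeFP QE strE (fun q => ((pcIs (layW W q.1.1.length) (layW W q.1.1.length).Nc (j q)).mapVars
      (rQ W q)).code) :=
  codeFP_QvecConst (W.P.length + 1) (codeFP_QNcb W) hj

/-- `allRegsEq` renamed. [folklore] -/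
theorem codeFP_QallRegs : CodeFP QE strE (fun q => ((allRegsEq (layW W q.1.1.length)).mapVars
      (rQ W q)).code) := by
  have hH : CodeFP QE natE (fun _ => W.P.length + 1) := const _ _
  have hK : CodeFP QE unE (fun _ => W.K) := const _ _
  have ha₀ := natAdd.comp ((codeFP_QNcb W).pair hH)
  have ha : CodeFP QE natE (fun q => (layW W q.1.1.length).Nc + (W.P.length + 1)) := ha₀
  have hm₀ := unMul.comp (hK.pair (codeFP_QWrU W))
  have hm : CodeFP QE unE (fun q => W.K * (layW W q.1.1.length).Wr) := hm₀
  exact codeFP_QvecEq ha hH hm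

/-- `beforeEq k` renamed. [folklore] -/
theorem codeFP_Qbefore : CodeFP QE strE (fun q => ((beforeEq (layW W q.1.1.length) q.2.2.1).mapVars
      (rQ W q)).code) := by
  have hH : CodeFP QE natE (fun _ => W.P.length + 1) := const _ _
  have ha₀ := natAdd.comp ((codeFP_QNcb W).pair hH)
  have ha : CodeFP QE natE (fun q => (layW W q.1.1.length).Nc + (W.P.length + 1)) := ha₀
  have hm₀ := unMul.comp (codeFP_QkU.pair (codeFP_QWrU W))
  have hm : CodeFP QE unE (fun q => q.2.2.1 * (layW W q.1.1.length).Wr) := hm₀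
  exact codeFP_QvecEq ha hH hm

/-- `afterEq k` renamed. [folklore] -/
theorem codeFP_Qafter : CodeFP QE strE (fun q => ((afterEq (layW W q.1.1.length) q.2.2.1).mapVars
      (rQ W q)).code) := by
  have hK : CodeFP QE unE (fun _ => W.K) := const _ _
  have c1 : CodeFP QE unE (fun _ => 1) := const _ _
  have ha₀ := natAdd.comp ((codeFP_QNcb W).pair (codeFP_Qoff1 W))
  have ha : CodeFP QE natE (fun q => (layW W q.1.1.length).Nc + (layW W q.1.1.length).off (q.2.2.1 + 1) 0) := ha₀
  have hs1₀ := unSub.comp (hK.pair codeFP_QkU)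
  have hs1 : CodeFP QE unE (fun q => W.K - q.2.2.1) := hs1₀
  have hs2₀ := unSub.comp (hs1.pair c1)
  have hs2 : CodeFP QE unE (fun q => W.K - q.2.2.1 - 1) := hs2₀
  have hm₀ := unMul.comp (hs2.pair (codeFP_QWrU W))
  have hm : CodeFP QE unE (fun q => (W.K - q.2.2.1 - 1) * (layW W q.1.1.length).Wr) := hm₀
  exact codeFP_QvecEq ha (codeFP_Qoff1 W) hm

/-- The pushed cell `vecConst (Nc + off k 0) (onehot Wc (a + 1))` renamed. [folklore] -/
theorem codeFP_QpushCell : CodeFP QE strE (fun q => ((vecConst ((layW W q.1.1.length).Nc + (layW W q.1.1.length).off q.2.2.1 0)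
      (onehot (layW W q.1.1.length).Wc (q.2.2.2.1 + 1))).mapVars (rQ W q)).code) := by
  have hbase₀ := natAdd.comp ((codeFP_QNcb W).pair (codeFP_Qoff0 W))
  have hbase : CodeFP QE natE (fun q => (layW W q.1.1.length).Nc + (layW W q.1.1.length).off q.2.2.1 0) := hbase₀
  have c1 : CodeFP QE natE (fun _ => 1) := const _ _
  have hsym : CodeFP QE natE (fun q => q.2.2.2.1) := (snd _ _).snd'.snd'.fst'
  have hj₀ := natAdd.comp (hsym.pair c1)
  have hj : CodeFP QE natE (fun q => q.2.2.2.1 + 1) := hj₀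
  exact codeFP_QvecConst (W.N + 2) hbase hj

/-- The push shift `vecEq (Nc + (off k 0 + Wc)) (off k 0) ((cap - 1) Wc)` renamed. [folklore] -/
theorem codeFP_QpushShift : CodeFP QE strE (fun q => ((vecEq ((layW W q.1.1.length).Nc + ((layW W q.1.1.length).off q.2.2.1 0 +
      (layW W q.1.1.length).Wc)) ((layW W q.1.1.length).off q.2.2.1 0) (((layW W q.1.1.length).cap - 1) * (layW W q.1.1.length).Wc)).mapVars
        (rQ W q)).code) := by
  have hWc : CodeFP QE natE (fun _ => W.N + 2) := const _ _
  have h1₀ := natAdd.comp ((codeFP_Qoff0 W).pair hWc)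
  have h1 : CodeFP QE natE (fun q => (layW W q.1.1.length).off q.2.2.1 0 + (layW W q.1.1.length).Wc) := h1₀
  have ha₀ := natAdd.comp ((codeFP_QNcb W).pair h1)
  have ha : CodeFP QE natE (fun q => (layW W q.1.1.length).Nc + ((layW W q.1.1.length).off q.2.2.1 0 + (layW W q.1.1.length).Wc)) := ha₀
  exact codeFP_QvecEq ha (codeFP_Qoff0 W) (codeFP_QshiftU W)

/-- The pop shift `vecEq (Nc + off k 0) (off k 0 + Wc) ((cap - 1) Wc)` renamed. [folklore] -/
theorem codeFP_QpopShift : CodeFP QE strE (fun q => ((vecEq ((layW W q.1.1.length).Nc + (layW W q.1.1.length).off q.2.2.1 0)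
      ((layW W q.1.1.length).off q.2.2.1 0 + (layW W q.1.1.length).Wc) (((layW W q.1.1.length).cap - 1) * (layW W q.1.1.length).Wc)).mapVars
        (rQ W q)).code) := by
  have hWc : CodeFP QE natE (fun _ => W.N + 2) := const _ _
  have ha₀ := natAdd.comp ((codeFP_QNcb W).pair (codeFP_Qoff0 W))
  have ha : CodeFP QE natE (fun q => (layW W q.1.1.length).Nc + (layW W q.1.1.length).off q.2.2.1 0) := ha₀
  have hb₀ := natAdd.comp ((codeFP_Qoff0 W).pair hWc)
  have hb : CodeFP QE natE (fun q => (layW W q.1.1.length).off q.2.2.1 0 + (layW W q.1.1.length).Wc) := hb₀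
  exact codeFP_QvecEq ha hb (codeFP_QshiftU W)

/-- The blank last cell after a pop, `vecConst (Nc + (off k 0 + (cap - 1) Wc)) (onehot Wc 0)`, renamed. [folklore] -/
theorem codeFP_QpopBlank : CodeFP QE strE (fun q => ((vecConst ((layW W q.1.1.length).Nc + ((layW W q.1.1.length).off q.2.2.1 0 +
      ((layW W q.1.1.length).cap - 1) * (layW W q.1.1.length).Wc)) (onehot (layW W q.1.1.length).Wc 0)).mapVars
        (rQ W q)).code) := by
  have h1₀ := natAdd.comp ((codeFP_Qoff0 W).pair (codeFP_Qshiftb W))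
  have h1 : CodeFP QE natE (fun q => (layW W q.1.1.length).off q.2.2.1 0 + ((layW W q.1.1.length).cap - 1) * (layW W q.1.1.length).Wc) := h1₀
  have hbase₀ := natAdd.comp ((codeFP_QNcb W).pair h1)
  have hbase : CodeFP QE natE (fun q => (layW W q.1.1.length).Nc + ((layW W q.1.1.length).off q.2.2.1 0 +
      ((layW W q.1.1.length).cap - 1) * (layW W q.1.1.length).Wc)) := hbase₀
  have h0 : CodeFP QE natE (fun _ => 0) := const _ _
  exact codeFP_QvecConst (W.N + 2) hbase h0

/-- The jump-table constraint of a pop, `⋀_{v < Wc} (var (off k 0 + v) ⇒ pcIs Nc t[v])`, renamed.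
[cite: AroraBarakCC2009, Claim 4.4 (adjacent configurations)] -/
theorem codeFP_QpopTable : CodeFP QE strE (fun q => ((bigConj ((List.range (layW W q.1.1.length).Wc).map fun v =>
      impF (.var ((layW W q.1.1.length).off q.2.2.1 0 + v)) (pcIs (layW W q.1.1.length) (layW W q.1.1.length).Nc (q.2.2.2.2.2.getD v 0)))).mapVars
        (rQ W q)).code) := by
  -- context `q`, item `v`
  have hq : CodeFP (pairE QE natE) QE (fun s => s.1) := fst _ _
  have hv : CodeFP (pairE QE natE) natE (fun s => s.2) := snd _ _
  have ht : CodeFP (pairE QE natE) (rawE natE) (fun s => s.1.2.2.2.2.2) := hq.snd'.snd'.snd'.snd'.snd'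
  have hget₀ := (rawGetD natE natE_zero).comp (ht.pair hv)
  have hget : CodeFP (pairE QE natE) natE (fun s => s.1.2.2.2.2.2.getD s.2 0) := hget₀
  have hoffq₀ := (codeFP_Qoff0 W).comp hq
  have hoffq : CodeFP (pairE QE natE) natE (fun s => (layW W s.1.1.1.length).off s.1.2.2.1 0) := hoffq₀
  have hoff₀ := natAdd.comp (hoffq.pair hv)
  have hoff : CodeFP (pairE QE natE) natE (fun s => (layW W s.1.1.1.length).off s.1.2.2.1 0 + s.2) := hoff₀
  have hvar₀ := (codeFP_mvVar (codeFP_remapQN W)).comp ((CodeFP.id _).pair hoff)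
  have hvar : CodeFP (pairE QE natE) strE (fun s => varCode (rQN W s ((layW W s.1.1.1.length).off s.1.2.2.1 0 + s.2))) := hvar₀
  have hNc₀ := (codeFP_QNcb W).comp hq
  have hNc : CodeFP (pairE QE natE) natE (fun s => (layW W s.1.1.1.length).Nc) := hNc₀
  have hn : CodeFP (pairE QE natE) unE (fun _ => W.P.length + 1) := const _ _
  have hpc₀ := (codeFP_mvVecConstOnehot (codeFP_remapQN W) hn).comp ((CodeFP.id _).pair (hNc.pair hget))
  have hpc : CodeFP (pairE QE natE) strE (fun s => ((vecConst (layW W s.1.1.1.length).Nc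
      (onehot (W.P.length + 1) (s.1.2.2.2.2.2.getD s.2 0))).mapVars (rQN W s)).code) := hpc₀
  have c5 : CodeFP (pairE QE natE) strE (fun _ => [true, true, false, true, true, true, true, false]) := const _ _
  have hin₀ := strAppend.comp (hvar.pair hpc)
  have hitem₀ := strAppend.comp (c5.pair hin₀)
  have hitem : CodeFP (pairE QE natE) strE (fun s => [true, true, false, true, true, true, true, false] ++
      (varCode (rQN W s ((layW W s.1.1.1.length).off s.1.2.2.1 0 + s.2)) ++
        ((vecConst (layW W s.1.1.1.length).Nc (onehot (W.P.length + 1) (s.1.2.2.2.2.2.getD s.2 0))).mapVars (rQN W s)).code)) := hitem₀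
  have hWc : CodeFP QE unE (fun _ => W.N + 2) := const _ _
  have hrg₀ := urange.comp hWc
  have hrange : CodeFP QE (pairE QE (rawE natE)) (fun q => (q, List.range (W.N + 2))) := (CodeFP.id _).pair hrg₀
  have hl₀ := (map hitem).comp hrange
  have hj₀ := strJoin.comp hl₀
  have c011 : CodeFP QE strE (fun _ => [false, true, true]) := const _ _
  have hall₀ := strAppend.comp (hj₀.pair c011)
  refine hall₀.congr fun q => ?_
  dsimp only
  rw [mapVars_bigConj, code_bigConj, List.map_map, List.map_map]
  rfl

/-! ### The step template of the context, renamed, and its full code -/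

/-- **The constraint of a descriptor, renamed** (all instruction kinds, by case distinction on the
tag and on `k < K`). [cite: AroraBarakCC2009, Claim 4.4 and Thm. 4.13 (proof: φ_{M,x})] -/
theorem codeFP_QcaseOfData : CodeFP QE strE (fun q => ((caseOfData (layW W q.1.1.length) q.2).mapVars (rQ W q)).code) := by
  have hj : CodeFP QE natE (fun q => q.2.2.2.2.1) := (snd _ _).snd'.snd'.snd'.fst'
  have ht : CodeFP QE (rawE natE) (fun q => q.2.2.2.2.2) := (snd _ _).snd'.snd'.snd'.snd'
  have c0 : CodeFP QE natE (fun _ => 0) := const _ _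
  have hj0₀ := (rawGetD natE natE_zero).comp (ht.pair c0)
  have hj0 : CodeFP QE natE (fun q => q.2.2.2.2.2.getD 0 0) := hj0₀
  have hK : CodeFP QE natE (fun _ => W.K) := const _ _
  have hk₀ := natLt.comp (codeFP_Qkb.pair hK)
  have hk : CodeFP QE bitE (fun q => decide (q.2.2.1 < W.K)) := hk₀
  -- goto
  have hG := codeFP_mvConj (codeFP_QpcIs W hj) (codeFP_QallRegs W)
  -- push
  have hPU1 := codeFP_mvConj (codeFP_QpushShift W) (codeFP_Qafter W)
  have hPU2 := codeFP_mvConj (codeFP_QpushCell W) hPU1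
  have hPU3 := codeFP_mvConj (codeFP_Qbefore W) hPU2
  have hPUt := codeFP_mvConj (codeFP_QpcIs W hj) hPU3
  have hPU := codeFP_mvIte hk hPUt hG
  -- pop
  have hPO1 := codeFP_mvConj (codeFP_Qafter W) (codeFP_QpopTable W)
  have hPO2 := codeFP_mvConj (codeFP_QpopBlank W) hPO1
  have hPO3 := codeFP_mvConj (codeFP_QpopShift W) hPO2
  have hPOt := codeFP_mvConj (codeFP_Qbefore W) hPO3
  have hPOf := codeFP_mvConj (codeFP_QpcIs W hj0) (codeFP_QallRegs W)
  have hPO := codeFP_mvIte hk hPOt hPOf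
  -- halt
  have hHA := codeFP_QvecEq (W := W) (codeFP_QNcb W) c0 (codeFP_QNcU W)
  -- the tags
  have htag : CodeFP QE natE (fun q => q.2.1) := (snd _ _).fst'
  have c1 : CodeFP QE natE (fun _ => 1) := const _ _
  have c2 : CodeFP QE natE (fun _ => 2) := const _ _
  have ht0₀ := natEq.comp (htag.pair c0)
  have ht0 : CodeFP QE bitE (fun q => decide (q.2.1 = 0)) := ht0₀
  have ht1₀ := natEq.comp (htag.pair c1)
  have ht1 : CodeFP QE bitE (fun q => decide (q.2.1 = 1)) := ht1₀
  have ht2₀ := natEq.comp (htag.pair c2)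
  have ht2 : CodeFP QE bitE (fun q => decide (q.2.1 = 2)) := ht2₀
  have h3 := codeFP_mvIte ht2 hPO hHA
  have h2 := codeFP_mvIte ht1 hPU h3
  have h1 := codeFP_mvIte ht0 hG h2
  exact h1.congr fun q => rfl

/-- **One guarded item `var p ⇒ caseAt p` of the step template, renamed**, from `((x, a, b), p)`
through the instruction table. [cite: AroraBarakCC2009, Thm. 4.13 (proof)] -/
theorem codeFP_itemCode : CodeFP (pairE CE natE) strE
    (fun s => ((impF (.var s.2) (caseAt (layW W s.1.1.length) W.P s.2)).mapVars (rC W s.1)).code) := by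
  have htab₀ := (codeFP_table W).comp (snd CE natE)
  have hq₀ := (fst CE natE).pair htab₀
  have hq : CodeFP (pairE CE natE) QE (fun s => (s.1, instrData W.P[s.2]?)) := hq₀
  have hcase₀ := (codeFP_QcaseOfData W).comp hq
  have hcase : CodeFP (pairE CE natE) strE (fun s => ((caseOfData (layW W s.1.1.length) (instrData W.P[s.2]?)).mapVars
      (rQ W (s.1, instrData W.P[s.2]?))).code) := hcase₀
  have hvar : CodeFP (pairE CE natE) strE (fun s => varCode (rC W s.1 s.2)) := codeFP_mvVar (codeFP_remapW W)
  have c5 : CodeFP (pairE CE natE) strE (fun _ => [true, true, true, true, false]) := const _ _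
  have hin₀ := strAppend.comp (hvar.pair hcase)
  have hall₀ := strAppend.comp (c5.pair hin₀)
  refine hall₀.congr fun s => ?_
  dsimp only
  rw [code_mapVars_impF_var, caseAt_eq_caseOfData]
  rfl

/-- **The code of the step template renamed to the blocks of the context is polynomial-time.**
[cite: AroraBarakCC2009, Thm. 4.13 (proof, p. 112: "ψ can be computed in polynomial time")] -/
theorem codeFP_stepCode : CodeFP CE strE (fun c => ((stepTpl (layW W c.1.length) W.P).mapVars (rC W c)).code) := by
  have c110 : CodeFP (pairE CE natE) strE (fun _ => [true, true, false]) := const _ _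
  have hg₀ := strAppend.comp (c110.pair (codeFP_itemCode W))
  have hH : CodeFP CE unE (fun _ => W.P.length + 1) := const _ _
  have hrg₀ := urange.comp hH
  have hrange : CodeFP CE (pairE CE (rawE natE)) (fun c => (c, List.range (W.P.length + 1))) := (CodeFP.id _).pair hrg₀
  have hl₀ := (map hg₀).comp hrange
  have hj₀ := strJoin.comp hl₀
  have c011 : CodeFP CE strE (fun _ => [false, true, true]) := const _ _
  have hall₀ := strAppend.comp (hj₀.pair c011)
  refine hall₀.congr fun c => ?_
  dsimp only
  rw [stepTpl, mapVars_bigConj, code_bigConj, List.map_map, List.map_map]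
  rfl

/-- The step formula of part III is the step template renamed by `rC`. [folklore] -/
theorem ofTpl_stepTpl_eq (c : List Bool × (ℕ × ℕ)) :
    ofTpl (layW W c.1.length).Nc (stepTpl (layW W c.1.length) W.P) c.2.1 c.2.2 = (stepTpl (layW W c.1.length) W.P).mapVars (rC W c) := by
  rw [ofTpl]
  rfl

/-- **The generator of the step formula `ofTpl Nc (stepTpl Λ P) a b` of part III**, in the full
code `⟨unary size, code⟩`. [cite: AroraBarakCC2009, Thm. 4.13 (proof, p. 112)] -/
theorem codeFP_stepEncode : CodeFP CE strE (fun c => encodingPropForm.encode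
    (ofTpl (layW W c.1.length).Nc (stepTpl (layW W c.1.length) W.P) c.2.1 c.2.2)) := by
  have h1 := codeFP_stepCode W
  have h2 : CodeFP CE strE (fun c => (ofTpl (layW W c.1.length).Nc (stepTpl (layW W c.1.length) W.P) c.2.1 c.2.2).code) :=
    h1.congr fun c => (congrArg PropForm.code (ofTpl_stepTpl_eq W c)).symm
  exact codeFP_encode_of_code h2

/-! ### The acceptance template of the context, renamed -/

/-- The renaming of the acceptance context `(x, a)`: `v ↦ a + v` (part III's `ofTpl₁`). [folklore] -/
def rA (s : List Bool × ℕ) (v : ℕ) : ℕ := s.2 + v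

/-- The acceptance renaming is polynomial-time. [folklore] -/
theorem codeFP_rA : CodeFP (pairE (pairE strE natE) natE) natE (fun u => rA u.1 u.2) := by
  have h₀ := natAdd.comp ((fst (pairE strE natE) natE).snd'.pair (snd (pairE strE natE) natE))
  exact h₀

/-- **The code of the acceptance template renamed to its block is polynomial-time.**
[cite: AroraBarakCC2009, Thm. 4.13 (proof: C_accept)] -/
theorem codeFP_accCode : CodeFP (pairE strE natE) strE
    (fun s => ((accTpl (layW W s.1.length) W.k₁ W.acc).mapVars (rA s)).code) := by
  by_cases hk : W.k₁ < W.K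
  · have hWr₀ := (codeFP_WrWb W).comp (fst strE natE)
    have hWr : CodeFP (pairE strE natE) natE (fun s => (layW W s.1.length).Wr) := hWr₀
    have hH : CodeFP (pairE strE natE) natE (fun _ => W.P.length + 1) := const _ _
    have hk₁ : CodeFP (pairE strE natE) natE (fun _ => W.k₁) := const _ _
    have c0W : CodeFP (pairE strE natE) natE (fun _ => 0 * (W.N + 2)) := const _ _
    have c1W : CodeFP (pairE strE natE) natE (fun _ => 1 * (W.N + 2)) := const _ _
    have hm₀ := natMul.comp (hk₁.pair hWr)
    have hb₀ := natAdd.comp (hH.pair hm₀)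
    have hoff0₀ := natAdd.comp (hb₀.pair c0W)
    have hoff0 : CodeFP (pairE strE natE) natE (fun s => (layW W s.1.length).off W.k₁ 0) := hoff0₀
    have hoff1₀ := natAdd.comp (hb₀.pair c1W)
    have hoff1 : CodeFP (pairE strE natE) natE (fun s => (layW W s.1.length).off W.k₁ 1) := hoff1₀
    have hn : CodeFP (pairE strE natE) unE (fun _ => W.N + 2) := const _ _
    have hacc : CodeFP (pairE strE natE) natE (fun _ => W.acc + 1) := const _ _
    have h0 : CodeFP (pairE strE natE) natE (fun _ => 0) := const _ _
    have hv1₀ := (codeFP_mvVecConstOnehot codeFP_rA hn).comp ((CodeFP.id _).pair (hoff0.pair hacc))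
    have hv1 : CodeFP (pairE strE natE) strE (fun s => ((vecConst ((layW W s.1.length).off W.k₁ 0)
        (onehot (layW W s.1.length).Wc (W.acc + 1))).mapVars (rA s)).code) := hv1₀
    have hv2₀ := (codeFP_mvVecConstOnehot codeFP_rA hn).comp ((CodeFP.id _).pair (hoff1.pair h0))
    have hv2 : CodeFP (pairE strE natE) strE (fun s => ((vecConst ((layW W s.1.length).off W.k₁ 1)
        (onehot (layW W s.1.length).Wc 0)).mapVars (rA s)).code) := hv2₀
    exact (codeFP_mvConj hv1 hv2).congr fun s => by rw [accTpl, if_pos ⟨hk, two_le_cap_layW W _⟩]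
  · have hc : CodeFP (pairE strE natE) strE (fun _ => [false, true, false]) := const _ _
    exact hc.congr fun s => by rw [accTpl, if_neg (fun h => hk h.1)]; rfl

/-- The acceptance formula of part III is the acceptance template renamed by `rA`. [folklore] -/
theorem ofTpl₁_accTpl_eq (s : List Bool × ℕ) :
    ofTpl₁ (accTpl (layW W s.1.length) W.k₁ W.acc) s.2 = (accTpl (layW W s.1.length) W.k₁ W.acc).mapVars (rA s) := by
  rw [ofTpl₁]
  rfl

/-- **The generator of the acceptance formula `ofTpl₁ (accTpl Λ k₁ acc) a` of part III.**
[cite: AroraBarakCC2009, Thm. 4.13 (proof)] -/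
theorem codeFP_accEncode : CodeFP (pairE strE natE) strE (fun s => encodingPropForm.encode
    (ofTpl₁ (accTpl (layW W s.1.length) W.k₁ W.acc) s.2)) := by
  have h1 := codeFP_accCode W
  have h2 : CodeFP (pairE strE natE) strE (fun s => (ofTpl₁ (accTpl (layW W s.1.length) W.k₁ W.acc) s.2).code) :=
    h1.congr fun s => (congrArg PropForm.code (ofTpl₁_accTpl_eq W s)).symm
  exact codeFP_encode_of_code h2

/-! ### The start word -/

/-- The generator of one-hot words of a fixed length. [folklore] -/
theorem codeFP_onehot (n : ℕ) : CodeFP natE strE (fun j => onehot n j) := by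
  have hg : CodeFP (pairE natE natE) strE (fun t => [decide (t.1 = t.2)]) := natEq.recodeOut fun _ => rfl
  have hr : CodeFP natE (rawE natE) (fun _ => List.range n) := const _ _
  have hl₀ := (map hg).comp ((CodeFP.id natE).pair hr)
  have hj₀ := strJoin.comp hl₀
  exact hj₀.congr fun j => flatten_map_singleton _ _

/-- The cell values of the initial stacks: stack `k₀` holds the coded input letters, the other stacks
are empty. [cite: AroraBarakCC2009, Thm. 4.13 (proof: C_start)] -/
def initVal (x : List Bool) (k i : ℕ) : ℕ :=
  if k = W.k₀ then (if i < x.length then (if x.getD i false then W.code true + 1 else W.code false + 1) else 0) else 0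

/-- The stacks of the initial configuration. [folklore] -/
theorem getD_initStk (x : List Bool) {k : ℕ} (hk : k < W.K) :
    (initStk W.K W.k₀ W.code x).getD k [] = if k = W.k₀ then x.map W.code else [] := by
  rw [initStk, List.getD_eq_getElem?_getD, List.getElem?_ofFn]
  simp [hk]

/-- The cell values of the initial configuration are `initVal`. [folklore] -/
theorem cellVal_initStk (x : List Bool) {k : ℕ} (hk : k < W.K) (i : ℕ) :
    cellVal ((initStk W.K W.k₀ W.code x).getD k []) i = initVal W x k i := by
  rw [getD_initStk W x hk, initVal]
  by_cases hk₀ : k = W.k₀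
  · rw [if_pos hk₀, if_pos hk₀]
    by_cases hi : i < x.length
    · rw [if_pos hi, cellVal_of_lt (by simpa using hi), List.getElem_map, List.getD_eq_getElem?_getD,
        List.getElem?_eq_getElem hi, Option.getD_some]
      cases x[i] <;> rfl
    · rw [if_neg hi, cellVal_of_le (by simpa using Nat.le_of_not_lt hi)]
  · rw [if_neg hk₀, if_neg hk₀, cellVal_of_le (by simp)]

/-- The generator of the initial cell values, from `(x, k, i)`. [folklore] -/
theorem codeFP_initVal : CodeFP (pairE strE (pairE natE natE)) natE (fun t => initVal W t.1 t.2.1 t.2.2) := by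
  have hx : CodeFP (pairE strE (pairE natE natE)) strE (fun t => t.1) := fst _ _
  have hk : CodeFP (pairE strE (pairE natE natE)) natE (fun t => t.2.1) := (snd _ _).fst'
  have hi : CodeFP (pairE strE (pairE natE natE)) natE (fun t => t.2.2) := (snd _ _).snd'
  have hk₀ : CodeFP (pairE strE (pairE natE natE)) natE (fun _ => W.k₀) := const _ _
  have c1₀ := natEq.comp (hk.pair hk₀)
  have c1 : CodeFP (pairE strE (pairE natE natE)) bitE (fun t => decide (t.2.1 = W.k₀)) := c1₀
  have hlen₀ := strNatLength.comp hx
  have c2₀ := natLt.comp (hi.pair hlen₀)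
  have c2 : CodeFP (pairE strE (pairE natE natE)) bitE (fun t => decide (t.2.2 < t.1.length)) := c2₀
  have hex₀ := strExplode.comp hx
  have hblk₀ := (rawGetD strE (d := ([] : List Bool)) rfl).comp (hex₀.pair hi)
  have hblk : CodeFP (pairE strE (pairE natE natE)) strE (fun t => (t.1.map fun b => [b]).getD t.2.2 []) := hblk₀
  have htrue : CodeFP (pairE strE (pairE natE natE)) strE (fun _ => [true]) := const _ _
  have c3₀ := (CodeFP.eq (eα := strE) fun _ _ h => h).comp (hblk.pair htrue)
  have c3 : CodeFP (pairE strE (pairE natE natE)) bitE (fun t => decide ((t.1.map fun b => [b]).getD t.2.2 [] = [true])) := c3₀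
  have vT : CodeFP (pairE strE (pairE natE natE)) natE (fun _ => W.code true + 1) := const _ _
  have vF : CodeFP (pairE strE (pairE natE natE)) natE (fun _ => W.code false + 1) := const _ _
  have v0 : CodeFP (pairE strE (pairE natE natE)) natE (fun _ => 0) := const _ _
  refine ((c1.ite (c2.ite (c3.ite vT vF) v0) v0).congr fun t => ?_)
  obtain ⟨x, k, i⟩ := t
  simp only [initVal]
  by_cases hk₀' : k = W.k₀
  · simp only [hk₀', decide_true, if_true]
    by_cases hi' : i < x.length
    · have hb : (x.map fun b => [b]).getD i [] = [x.getD i false] := by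
        rw [List.getD_eq_getElem?_getD, List.getElem?_map, List.getElem?_eq_getElem hi', Option.map_some,
          Option.getD_some, List.getD_eq_getElem?_getD, List.getElem?_eq_getElem hi', Option.getD_some]
      simp only [hi', decide_true, if_true, hb]
      cases x.getD i false <;> simp
    · simp [hi']
  · simp [hk₀']

/-- **The start word `enc (cfgW W x 0)` is polynomial-time**: the one-hot counter `pc₀`, then stack
by stack and cell by cell the one-hot cell values of the initial stacks. [cite: AroraBarakCC2009, Thm. 4.13 (proof: C_start computed from x)] -/
theorem codeFP_startW : CodeFP strE strE (fun x => (layW W x.length).enc (cfgW W x 0)) := by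
  -- one cell, from the context `((x, k), i)`
  have hargs : CodeFP (pairE (pairE strE natE) natE) (pairE strE (pairE natE natE)) (fun t => (t.1.1, (t.1.2, t.2))) :=
    (fst _ _).fst'.pair ((fst _ _).snd'.pair (snd _ _))
  have hval₀ := (codeFP_initVal W).comp hargs
  have hcell₀ := (codeFP_onehot (W.N + 2)).comp hval₀
  have hcell : CodeFP (pairE (pairE strE natE) natE) strE (fun t => onehot (W.N + 2) (initVal W t.1.1 t.1.2 t.2)) := hcell₀
  -- one region, from the context `(x, k)`
  have hx : CodeFP (pairE strE natE) strE (fun t => t.1) := fst _ _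
  have hcap₀ := (codeFP_capW W).comp hx
  have hrg₀ := urange.comp hcap₀
  have hrange : CodeFP (pairE strE natE) (pairE (pairE strE natE) (rawE natE)) (fun t => (t, List.range (layW W t.1.length).cap)) :=
    (CodeFP.id _).pair hrg₀
  have hreg₀ := (map hcell).comp hrange
  have hregj₀ := strJoin.comp hreg₀
  have hreg : CodeFP (pairE strE natE) strE
      (fun t => ((List.range (layW W t.1.length).cap).map fun i => onehot (W.N + 2) (initVal W t.1 t.2 i)).flatten) :=
    hregj₀.congr fun _ => rfl
  -- all regions
  have hK : CodeFP strE (rawE natE) (fun _ => List.range W.K) := const _ _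
  have hrangeK : CodeFP strE (pairE strE (rawE natE)) (fun x => (x, List.range W.K)) := (CodeFP.id strE).pair hK
  have hregs₀ := (map hreg).comp hrangeK
  have hregsj₀ := strJoin.comp hregs₀
  have hregs : CodeFP strE strE (fun x => ((List.range W.K).map fun k =>
      ((List.range (layW W x.length).cap).map fun i => onehot (W.N + 2) (initVal W x k i)).flatten).flatten) :=
    hregsj₀.congr fun _ => rfl
  have hpc : CodeFP strE strE (fun _ => onehot (W.P.length + 1) W.pc₀) := const _ _
  have hall₀ := strAppend.comp (hpc.pair hregs)
  refine hall₀.congr fun x => ?_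
  dsimp only
  change _ = (layW W x.length).pcPart (cfgW W x 0) ++ (layW W x.length).regs (cfgW W x 0).2 (List.range (layW W x.length).K)
  simp only [Lay.pcPart, Lay.regs, cfgW, Function.iterate_zero, id]
  congr 2
  refine List.map_congr_left fun k hk => ?_
  simp only [Lay.reg]
  congr 1
  refine List.map_congr_left fun i _ => ?_
  rw [cellVal_initStk W x (List.mem_range.1 hk)]
  rfl

/-! ### The reduction -/

/-- **The code of the flat QBF is computed by an `FP` function**: `x ↦ (flatQBF W x).encode` on codes,
through the generic emitter of part III′ (`codeFP_encode_savitchQBF`). [cite: AroraBarakCC2009, Thm. 4.13 (proof, p. 112: "ψ can be computed in polynomial time")] -/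
theorem codeFP_encode_flatQBF : CodeFP strE strE (fun x => (flatQBF W x).encode) := by
  have h := codeFP_encode_savitchQBF (σ := List Bool) (eσ := strE)
    (Φ := fun x a b => ofTpl (layW W x.length).Nc (stepTpl (layW W x.length) W.P) a b)
    (acc := fun x a => ofTpl₁ (accTpl (layW W x.length) W.k₁ W.acc) a)
    (start := fun x => (layW W x.length).enc (cfgW W x 0))
    (N := fun x => (layW W x.length).Nc) (m := fun x => (layW W x.length).Nc)
    (codeFP_stepEncode W) (codeFP_accEncode W) (codeFP_startW W) (codeFP_NcW W) (codeFP_NcW W)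
  exact h.congr fun x => rfl

end Witness

open scoped Literature.Computability.Complexity.Notation in
/-- **`L ≤ₚ TQBF` for every language with a flat witness** (Arora–Barak, Thm. 4.13, hardness half,
for the tree's flattened space machines). [cite: AroraBarakCC2009, Thm. 4.13] -/
theorem karpReducible_TQBF {L : Language Bool} (W : FlatWitness L) : L ≤ₚ TQBF := by
  obtain ⟨f, hf, hfx⟩ := codeFP_encode_flatQBF W
  refine polyTimeKarpReducible_iff.2 ⟨f, hf, fun x => ?_⟩
  rw [show f x = (flatQBF W x).encode from hfx x]
  exact mem_iff_encode_flatQBF_mem_TQBF W x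

/-- **`TQBF` is `PSPACE`-hard** (Stockmeyer–Meyer 1973; Arora–Barak 2009, Thm. 4.13): every
`L ∈ PSPACE` has a flat witness (`FlatProg.exists_flatWitness`) and hence Karp-reduces to `TQBF`.
[cite: AroraBarakCC2009, Thm. 4.13] -/
theorem isHard_PSPACE_TQBF : IsHard PSPACE TQBF := fun _ hL => by
  obtain ⟨W⟩ := exists_flatWitness hL
  exact karpReducible_TQBF W

/-- **`TQBF` is `PSPACE`-complete** (Stockmeyer–Meyer 1973; Arora–Barak 2009, Thm. 4.13): membership
(`TQBF_mem_PSPACE`, `TQBFMembership.lean`) and hardness (`isHard_PSPACE_TQBF`), for the tree's `TQBF`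
(`AaronsonChenOracle.lean`), `PSPACE` (`Space.lean`) and Karp completeness (`Reductions.lean`).
[cite: AroraBarakCC2009, Thm. 4.13] -/
theorem isComplete_PSPACE_TQBF : IsComplete PSPACE TQBF :=
  ⟨TQBF_mem_PSPACE, isHard_PSPACE_TQBF⟩

end TQBFRed

end Literature.Barriers.QuantumAdvantage

end
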